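/-
Copyright: lit-balaban Phase-2 proof seat p34 (gen 18).  Statement-level skeleton of a published paper; no proof claims beyond what the
kernel checks below.
-/
import Literature.MathematicalPhysics.QuantumFieldTheory.BalabanImbrieJaffe1984to88.BIJ85ScalarPropagatorDecay
import Literature.MathematicalPhysics.QuantumFieldTheory.BalabanImbrieJaffe1984to88.BIJ88NeumannNoZeroModesTorus

/-!
# [BalabanImbrieJaffe1988] (2.27)/(2.30) p. 263 / [BalabanImbrieJaffe1985] §7.3 p. 326 — **THE BLOCK-CENTRED EXPONENTIAL WEIGHT
# `ψ_x(y) = tΣ_μ F(dist_μ(o_x, y))` ON THE FINE TORUS: bond-Lipschitz (`|Δ_bψ| ≤ t/L^k`), FLAT ACROSS THE FACES OF THE `k`-BLOCKS and at the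
# centre, with SECOND-ORDER one-step drift `Σ_μ(e^{Δ⁺_μψ} + e^{Δ⁻_μψ} − 2) ≤ D(8t + 2t²)/L^{2k}`, and comparable to the `ℓ^∞` distance
# (`ψ_x(y) ≥ t(|x−y|_∞/(2L^k) − 5/2)`)** — engine file 3a behind the `k`-uniform SUP-NORM (operator-form) decay of the REGION Neumann
# propagators on an ARBITRARY union of `k`-blocks: the weight of the Nash–Davies iteration (file 3b), for which p34's `ell1_step_le` applies

T. Bałaban, J. Imbrie, A. Jaffe, *Effective action and cluster properties of the abelian Higgs model*, Commun. Math. Phys. **114** (1988)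
257–315 [BalabanImbrieJaffe1988], Sect. 2 p. 263 [PDF 7], (2.27)/(2.30); [I] = T. Bałaban, J. Imbrie, A. Jaffe, *Renormalization of the Higgs
model: minimizers, propagators and the stability of mean field theory*, Commun. Math. Phys. **97** (1985) 299–329 [BalabanImbrieJaffe1985],
§7.3 p. 326 [PDF 28], (2.4) p. 302; [6] = T. Bałaban, *Regularity and decay of lattice Green's functions*, Commun. Math. Phys. **89** (1983)
571–597 [Balaban1983RegularityDecay], (1.10) p. 573; [12] = T. Bałaban, *Renormalization group approach to lattice gauge field theories. I*,
Commun. Math. Phys. **109** (1987) 249–301 [Balaban1987RG1], §0 (0.1) p. 251 (the torus `T^{(j)}` with `2L^{m+K−j}` sites per direction, `L` odd).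

statement-level skeleton of published theorems with citation tags; proofs where landed; nothing here is a claim about the Yang–Mills mass gap

PDF held: `paper:balaban1988-cmp114-bij-abelian-higgs-effective-action` (journal page = PDF page + 256), p. 262–263 [PDF 6–7];
`paper:balaban1985-cmp97-bij-higgs-minimizers` (journal page = PDF page + 298), p. 326 [PDF 28].

CITATION HEADER (lean-in-tree rule).  Part of the lit-balaban TYPED SKELETON (HOME `run/shared/lean/pub/lit-balaban/`), PHASE-2 proof seat
p34 gen 18 (unit `lit-balaban-p34-g18`; TAKING line HOME/STATUS.md 2026-08-23T04:22:50Z; free-target protocol G.5-34(d) — source: the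
owner's `HOME/lit-balaban-r18/C2S14-CLOSURE.md` v1.16s «REMAINING NON-FLAT FRONT (α′) operator-form (H1.10) for general regions at small u»).
WHAT IS REPRODUCED: nothing printed is restated — ENGINE file behind a located member of rows **C2.Eq2.30** (owner r18) and **C1.Eq7.3.1-7.3.2**
(owner r15), the (1.10) VALUE member in OPERATOR form for p31's region propagators on a GENERAL `k`-block union at non-flat small `u` (file 4).
USED BY NAME: r16's `LatticeFieldCalculus.supDist`, r18/p33's `supDist_triangle`, p33's `BIJ85ScalarPropagatorDecay.supDist_le_of_blkIter_eq`,
`BIJ85BlockKPoincare.val_blkIter`, p11's `blkIter`/`blockK`, p31's `IsBlockUnion`, r18's `starB`.  Kind: small definitions with body (the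
profile `beta`/`prof`, the circle distance `cdist`, the block centre `ctr`/`centre`, the weight `psi`) + theorems; no `Prop`-valued fact.

THE PRINTED TEXT (verbatim).  C2 p. 263 [PDF 7]: *"a straightforward application of the random walk expansion of [6] shows that
|(G_{k,loc}(u)f)(x)| ≦ ce^{−c dist(suppt f,x)}‖f‖_∞, (2.30)"*; [I] p. 326: *"The propagators arising from Δ_k(u_k), under the restriction
(7.3.1) on the gauge field, also satisfy the regularity and decay estimates of [7]"*.

THE MECHANISM (DIVERGENCE OF METHOD from [6]'s random walk expansion, disclosed).  The exponential weights of the lineage (`e^{t|x−·|_∞/L^k}`,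
p27 `weight_bond_osc`) have a first-order one-step drift at the sites where the `ℓ^∞` distance is not smooth and, for the REFLECTING walk of a
region, at every Neumann boundary site.  The weight of this file is built from a one-dimensional profile `F` (`prof`) of the circle distance
to the CENTRE of the `k`-block of `x` in each coordinate, whose increments `β(i) = min{1, min(i, u(i))/(n/8)}` (`n = L^k`,
`u(i) = (i + (n+1)/2) mod n` the position after the last block face) vanish on the bond at the centre and on every bond crossing a face of the
`k`-block partition and ramp up linearly over `n/8` bonds afterwards: hence `|ΔF| ≤ 1/n`, `Δ²F ≤ 8/n²` FROM ABOVE everywhere (the downward jumps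
before the faces are concave kinks, harmless), `F` is constant across the faces — so a missing neighbour of the reflecting walk contributes the
same `0` as a present one — and `F(d) ≥ d/(2n) − 2` (at most `(n/8+1)(d/n + 3)` increments are `< 1`).  The drift bound uses
`e^a + e^b − 2 ≤ (a + b) + a² + b²` for `|a|, |b| ≤ 1` and the three cases of the circle distance of the two neighbours (`d ± 1`; `1, 1` at the
centre; `d−1, d−1` at the antipode).

WHAT IS PROVED (0 `sorry`; standard axioms; definitions with body, no `Prop`-valued fact).
* §1 `beta`, `prof` (defs) and their calculus: `beta_nonneg`, `beta_le_one`, `beta_zero`, `beta_face`, `beta_succ_sub_le`, `prof_zero`,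
  `prof_succ`, `prof_mono`, `prof_sub_le`, `prof_second_diff_le`, `prof_face`, `prof_le`, `card_filter_mod_lt_le`, **`prof_ge`**.
* §2 `cdist` (def; the summand of r16's `supDist`), `cdist_eq_min`, **`cdist_neighbours`** (the three cases), `cdist_le_of_le`/`cdist_le_of_ge`,
  **`cdist_face`** (across a block face the profile argument steps through a flat increment).
* §3 `ctr`, `centre`, `psi` (defs); `val_ctr`, `blkIter_centre`, `cdist_ctr_le`, `supDist_centre_le`, `supDist_eq_sup_cdist`,
  **`psi_shift_sub_abs_le`**/**`psi_unshift_sub_abs_le`** (bond Lipschitz `t/L^k`), **`psi_shift_eq_of_not_mem_starB`** /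
  **`psi_unshift_eq_of_not_mem_starB`** (flat across the bonds leaving a `k`-block union), **`psi_drift_le`**, **`psi_ge`**, `psi_self_le`,
  `psi_nonneg`.

HONEST SCOPE.  Pure lattice analysis on the fine torus `Site P 0` (no gauge field); `n = L^k` with `1 ≤ k ≤ m + K` (so `n ≥ 3` odd and
`n ∣ 2L^{m+K}`); constants explicit.  Nothing here is summit progress.  Unit `lit-balaban-p34` (literature-prover-lit-balaban-p34-g18-0), HOME
`run/shared/lean/pub/lit-balaban/`, 2026-08-23.
-/

open scoped BigOperators
open Finset

namespace Literature.MathematicalPhysics.QuantumFieldTheory.BalabanImbrieJaffe1984to88.BIJ88BlockCentredWeight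

open Literature.MathematicalPhysics.QuantumFieldTheory.Balaban1983to89
open LatticeFieldCalculus (supDist shiftEquiv)
open BIJ88Sect3Statements (starB mem_starB)
open BIJ85BlockAveragesTorusK (blkIter blockK mem_blockK)
open BIJ85BlockKPoincare (val_blkIter)
open BIJ88NeumannNoZeroModesTorus (IsBlockUnion)

noncomputable section

/-! ## §1 The one-dimensional profile `F(d) = n⁻¹Σ_{i<d} β(i)` -/

section Profile

variable (n : ℕ)

/-- The increment `β(i) = min{1, min(i, u(i))/(n/8)}`, `u(i) = (i + (n+1)/2) mod n`, of the profile between circle distances `i` and `i+1`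
from a block centre: `0` on the centre bond `i = 0` and on the face bonds `i ≡ (n−1)/2 (mod n)`, ramping up over `n/8` bonds (kernel device of
the sup-norm route). [cite: BalabanImbrieJaffe1985, (7.3.2) p.326] -/
def beta (i : ℕ) : ℝ := min 1 (min (i : ℝ) (((i + (n + 1) / 2) % n : ℕ) : ℝ) / ((n : ℝ) / 8))

/-- The profile `F(d) = n⁻¹Σ_{i<d} β(i)` (kernel device of the sup-norm route). [cite: BalabanImbrieJaffe1985, (7.3.2) p.326] -/
def prof (d : ℕ) : ℝ := (n : ℝ)⁻¹ * ∑ i ∈ range d, beta n i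

variable {n}

/-- kernel: `0 ≤ β`. [cite: BalabanImbrieJaffe1985, (7.3.2) p.326] -/
theorem beta_nonneg (hn : 0 < n) (i : ℕ) : 0 ≤ beta n i := by
  unfold beta
  refine le_min zero_le_one (div_nonneg (le_min (Nat.cast_nonneg _) (Nat.cast_nonneg _)) ?_)
  have : (0 : ℝ) < n := by exact_mod_cast hn
  positivity

/-- kernel: `β ≤ 1`. [cite: BalabanImbrieJaffe1985, (7.3.2) p.326] -/
theorem beta_le_one (i : ℕ) : beta n i ≤ 1 := min_le_left _ _

/-- kernel: the centre bond is flat: `β(0) = 0`. [cite: BalabanImbrieJaffe1985, (7.3.2) p.326] -/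
theorem beta_zero : beta n 0 = 0 := by
  unfold beta
  have h0 : min ((0 : ℕ) : ℝ) ((((0 + (n + 1) / 2) % n : ℕ)) : ℝ) = 0 := by
    rw [Nat.cast_zero]; exact min_eq_left (Nat.cast_nonneg _)
  rw [h0, zero_div]
  exact min_eq_right zero_le_one

/-- kernel: the face bonds are flat: `n ∣ i + (n+1)/2 ⟹ β(i) = 0`. [cite: BalabanImbrieJaffe1985, (7.3.2) p.326] -/
theorem beta_face {i : ℕ} (h : n ∣ i + (n + 1) / 2) : beta n i = 0 := by
  have hu : (i + (n + 1) / 2) % n = 0 := Nat.mod_eq_zero_of_dvd h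
  have h0 : min (i : ℝ) ((((i + (n + 1) / 2) % n : ℕ)) : ℝ) = 0 := by
    rw [hu, Nat.cast_zero]; exact min_eq_right (Nat.cast_nonneg _)
  unfold beta
  rw [h0, zero_div]
  exact min_eq_right zero_le_one

/-- kernel: `(m+1) mod n` is `(m mod n) + 1` or `0`. [folklore] -/
private theorem succ_mod_cases (hn : 0 < n) (m : ℕ) : (m + 1) % n = m % n + 1 ∨ (m + 1) % n = 0 := by
  rcases Nat.lt_or_ge 1 n with h1 | h1
  · have e : (m + 1) % n = (m % n + 1) % n := by rw [Nat.add_mod, Nat.mod_eq_of_lt h1]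
    by_cases h : m % n + 1 < n
    · left; rw [e, Nat.mod_eq_of_lt h]
    · right
      have hlt : m % n < n := Nat.mod_lt _ hn
      have heq : m % n + 1 = n := by omega
      rw [e, heq, Nat.mod_self]
  · right
    have : n = 1 := by omega
    subst this
    exact Nat.mod_one _

/-- kernel: **the increments rise by at most `8/n` per step**: `β(i+1) − β(i) ≤ 8/n` (the downward jumps are free).
[cite: BalabanImbrieJaffe1985, (7.3.2) p.326] -/
theorem beta_succ_sub_le (hn : 0 < n) (i : ℕ) : beta n (i + 1) - beta n i ≤ 8 / n := by
  have hnr : (0 : ℝ) < n := by exact_mod_cast hn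
  have hw : (0 : ℝ) < (n : ℝ) / 8 := by positivity
  set A : ℝ := min (i : ℝ) ((((i + (n + 1) / 2) % n : ℕ)) : ℝ) with hA
  set A' : ℝ := min ((i + 1 : ℕ) : ℝ) ((((i + 1 + (n + 1) / 2) % n : ℕ)) : ℝ) with hA'
  have hA0 : 0 ≤ A := le_min (Nat.cast_nonneg _) (Nat.cast_nonneg _)
  have hstep : A' ≤ A + 1 := by
    have e : i + 1 + (n + 1) / 2 = (i + (n + 1) / 2) + 1 := by ring
    rcases succ_mod_cases hn (i + (n + 1) / 2) with h | h
    · rw [hA', e, h]; push_cast; rw [min_add_add_right]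
    · rw [hA', e, h]; push_cast
      exact (min_le_right _ _).trans (by linarith)
  have hb' : beta n (i + 1) = min 1 (A' / ((n : ℝ) / 8)) := rfl
  have hb : beta n i = min 1 (A / ((n : ℝ) / 8)) := rfl
  rw [hb', hb]
  have h8 : (0 : ℝ) ≤ 8 / n := by positivity
  have h2 : A' / ((n : ℝ) / 8) ≤ A / ((n : ℝ) / 8) + 8 / n := by
    rw [show (8 : ℝ) / n = 1 / ((n : ℝ) / 8) by field_simp, ← add_div]
    exact div_le_div_of_nonneg_right hstep hw.le
  rcases le_total 1 (A / ((n : ℝ) / 8)) with hc | hc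
  · rw [min_eq_left hc]; linarith [min_le_left (1 : ℝ) (A' / ((n : ℝ) / 8))]
  · rw [min_eq_right hc]; linarith [min_le_right (1 : ℝ) (A' / ((n : ℝ) / 8))]

/-- kernel: `F(0) = 0`. [cite: BalabanImbrieJaffe1985, (7.3.2) p.326] -/
theorem prof_zero : prof n 0 = 0 := by simp [prof]

/-- kernel: `F(d+1) = F(d) + β(d)/n`. [cite: BalabanImbrieJaffe1985, (7.3.2) p.326] -/
theorem prof_succ (d : ℕ) : prof n (d + 1) = prof n d + beta n d / n := by
  rw [prof, prof, sum_range_succ, mul_add, div_eq_inv_mul]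

/-- kernel: `0 ≤ F(d+1) − F(d) ≤ 1/n`. [cite: BalabanImbrieJaffe1985, (7.3.2) p.326] -/
theorem prof_sub_le (hn : 0 < n) (d : ℕ) : 0 ≤ prof n (d + 1) - prof n d ∧ prof n (d + 1) - prof n d ≤ 1 / n := by
  have hnr : (0 : ℝ) < n := by exact_mod_cast hn
  rw [prof_succ, add_sub_cancel_left]
  exact ⟨div_nonneg (beta_nonneg hn d) hnr.le, div_le_div_of_nonneg_right (beta_le_one d) hnr.le⟩

/-- kernel: `F` is nondecreasing. [cite: BalabanImbrieJaffe1985, (7.3.2) p.326] -/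
theorem prof_mono (hn : 0 < n) : Monotone (prof n) :=
  monotone_nat_of_le_succ fun d => by linarith [(prof_sub_le hn d).1]

/-- kernel: **the second differences of `F` are at most `8/n²`** (from above; no lower bound is claimed or needed).
[cite: BalabanImbrieJaffe1985, (7.3.2) p.326] -/
theorem prof_second_diff_le (hn : 0 < n) (d : ℕ) : prof n (d + 2) - 2 * prof n (d + 1) + prof n d ≤ 8 / (n : ℝ) ^ 2 := by
  have hnr : (0 : ℝ) < n := by exact_mod_cast hn
  have e : prof n (d + 2) - 2 * prof n (d + 1) + prof n d = (beta n (d + 1) - beta n d) / n := by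
    rw [show d + 2 = d + 1 + 1 by ring, prof_succ, prof_succ]; ring
  rw [e, div_le_iff₀ hnr]
  have h := beta_succ_sub_le hn d
  calc beta n (d + 1) - beta n d ≤ 8 / n := h
    _ = 8 / (n : ℝ) ^ 2 * n := by field_simp

/-- kernel: **`F` is flat across the faces**: `n ∣ d + (n+1)/2 ⟹ F(d+1) = F(d)`. [cite: BalabanImbrieJaffe1985, (7.3.2) p.326] -/
theorem prof_face {d : ℕ} (h : n ∣ d + (n + 1) / 2) : prof n (d + 1) = prof n d := by
  rw [prof_succ, beta_face h, zero_div, add_zero]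

/-- kernel: the centre bond is flat: `F(1) = F(0) = 0`. [cite: BalabanImbrieJaffe1985, (7.3.2) p.326] -/
theorem prof_one : prof n 1 = 0 := by
  rw [show (1 : ℕ) = 0 + 1 from rfl, prof_succ, beta_zero, prof_zero, zero_div, add_zero]

/-- kernel: `F(d) ≤ d/n`. [cite: BalabanImbrieJaffe1985, (7.3.2) p.326] -/
theorem prof_le (hn : 0 < n) (d : ℕ) : prof n d ≤ d / n := by
  have hnr : (0 : ℝ) < n := by exact_mod_cast hn
  unfold prof
  rw [div_eq_inv_mul]
  refine mul_le_mul_of_nonneg_left ?_ (inv_nonneg.2 hnr.le)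
  calc ∑ i ∈ range d, beta n i ≤ ∑ i ∈ range d, (1 : ℝ) := sum_le_sum fun i _ => beta_le_one i
    _ = d := by simp

/-- kernel: `0 ≤ F`. [cite: BalabanImbrieJaffe1985, (7.3.2) p.326] -/
theorem prof_nonneg (hn : 0 < n) (d : ℕ) : 0 ≤ prof n d := by
  have h := prof_mono hn (Nat.zero_le d)
  rwa [prof_zero] at h

/-- kernel: **counting the residues**: among `i < d`, at most `(d/n + 2)·W` have `(i + c) mod n < W` (the map `i ↦ ((i+c)/n, (i+c) mod n)` is
injective). [folklore] -/
private theorem card_filter_mod_lt_le (hn : 0 < n) {c : ℕ} (hc : c < n) (d W : ℕ) :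
    ((range d).filter (fun i => (i + c) % n < W)).card ≤ (d / n + 2) * W := by
  classical
  set S := (range d).filter (fun i => (i + c) % n < W) with hS
  have hmap : ∀ i ∈ S, ((i + c) / n, (i + c) % n) ∈ (range (d / n + 2)) ×ˢ (range W) := by
    intro i hi
    rw [hS, mem_filter, mem_range] at hi
    rw [mem_product, mem_range, mem_range]
    refine ⟨?_, hi.2⟩
    have h1 : (i + c) / n ≤ (d + n) / n := Nat.div_le_div_right (by omega)
    rw [Nat.add_div_right _ hn] at h1
    omega
  have hinj : Set.InjOn (fun i => ((i + c) / n, (i + c) % n)) S := by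
    intro i _ i' _ h
    simp only [Prod.mk.injEq] at h
    have e1 := Nat.div_add_mod (i + c) n
    have e2 := Nat.div_add_mod (i' + c) n
    rw [h.1, h.2] at e1
    omega
  calc S.card ≤ ((range (d / n + 2)) ×ˢ (range W)).card := card_le_card_of_injOn _ hmap hinj
    _ = (d / n + 2) * W := by rw [card_product, card_range, card_range]

/-- **THE PROFILE GROWS LINEARLY**: `F(d) ≥ d/(2n) − 2` for `n ≥ 3` (an increment is `< 1` only if `i < n/8` or `(i + (n+1)/2) mod n < n/8`;
at most `(n/8 + 1) + (d/n + 2)(n/8 + 1)` of the first `d` increments do). [cite: BalabanImbrieJaffe1985, (7.3.2) p.326] -/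
theorem prof_ge (hn : 3 ≤ n) (d : ℕ) : (d : ℝ) / (2 * n) - 2 ≤ prof n d := by
  classical
  have hn0 : 0 < n := by omega
  have hnr : (3 : ℝ) ≤ n := by exact_mod_cast hn
  have hnpos : (0 : ℝ) < n := by linarith
  set w : ℝ := (n : ℝ) / 8 with hw
  have hwpos : 0 < w := by positivity
  set W : ℕ := ⌈w⌉₊ with hW
  have hWle : (W : ℝ) ≤ w + 1 := (Nat.ceil_lt_add_one hwpos.le).le
  set c : ℕ := (n + 1) / 2 with hcdef
  have hc : c < n := by omega
  -- an increment is `1` unless `i < W` or `(i + c) mod n < W`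
  have hβ : ∀ i, (1 : ℝ) - (if i < W then 1 else 0) - (if (i + c) % n < W then 1 else 0) ≤ beta n i := by
    intro i
    by_cases h1 : i < W
    · rw [if_pos h1]; have := beta_nonneg hn0 i; split_ifs <;> linarith
    · by_cases h2 : (i + c) % n < W
      · rw [if_neg h1, if_pos h2]; linarith [beta_nonneg hn0 i]
      · rw [if_neg h1, if_neg h2, sub_zero, sub_zero]
        -- both distances are `≥ W ≥ w`, so the increment is `1`
        have hi : w ≤ (i : ℝ) := (Nat.le_ceil w).trans (by exact_mod_cast not_lt.1 h1)
        have hu : w ≤ ((((i + (n + 1) / 2) % n : ℕ)) : ℝ) := (Nat.le_ceil w).trans (by exact_mod_cast not_lt.1 h2)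
        have hmin : w ≤ min (i : ℝ) ((((i + (n + 1) / 2) % n : ℕ)) : ℝ) := le_min hi hu
        have hge : 1 ≤ min (i : ℝ) ((((i + (n + 1) / 2) % n : ℕ)) : ℝ) / ((n : ℝ) / 8) := by
          rw [le_div_iff₀ hwpos, one_mul]; exact hmin
        unfold beta
        rw [min_eq_left hge]
  -- summing
  have hsum : (d : ℝ) - ∑ i ∈ range d, (if i < W then (1 : ℝ) else 0) - ∑ i ∈ range d, (if (i + c) % n < W then (1 : ℝ) else 0)
      ≤ ∑ i ∈ range d, beta n i := by
    have h := sum_le_sum fun i (_ : i ∈ range d) => hβ i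
    rw [sum_sub_distrib, sum_sub_distrib, sum_const, card_range, nsmul_eq_mul, mul_one] at h
    exact h
  -- the two counts
  have hcnt1 : ∑ i ∈ range d, (if i < W then (1 : ℝ) else 0) ≤ W := by
    rw [sum_boole]
    have : ((range d).filter (fun i => i < W)).card ≤ W := by
      calc ((range d).filter (fun i => i < W)).card ≤ (range W).card :=
            card_le_card fun i hi => by rw [mem_filter] at hi; exact mem_range.2 hi.2
        _ = W := card_range W
    exact_mod_cast this
  have hcnt2 : ∑ i ∈ range d, (if (i + c) % n < W then (1 : ℝ) else 0) ≤ ((d : ℝ) / n + 2) * W := by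
    rw [sum_boole]
    have h := card_filter_mod_lt_le hn0 hc d W
    have h' : (((range d).filter (fun i => (i + c) % n < W)).card : ℝ) ≤ ((d / n + 2 : ℕ) : ℝ) * W := by exact_mod_cast h
    refine h'.trans (mul_le_mul_of_nonneg_right ?_ (Nat.cast_nonneg _))
    push_cast
    linarith [Nat.cast_div_le (m := d) (n := n) (α := ℝ)]
  -- assembly: `Σβ ≥ d − W − (d/n + 2)W ≥ d/2 − 2n`
  have hS : (d : ℝ) / 2 - 2 * n ≤ ∑ i ∈ range d, beta n i := by
    have hW' : (W : ℝ) ≤ n / 8 + 1 := by rw [hw] at hWle; exact hWle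
    have hd0 : (0 : ℝ) ≤ d := Nat.cast_nonneg _
    have h1 : ((d : ℝ) / n + 2) * W ≤ ((d : ℝ) / n + 2) * (n / 8 + 1) := mul_le_mul_of_nonneg_left hW' (by positivity)
    have h2 : ((d : ℝ) / n + 2) * (n / 8 + 1) = d / 8 + d / n + n / 4 + 2 := by field_simp; ring
    have h3 : (d : ℝ) / n ≤ d / 3 := div_le_div_of_nonneg_left hd0 (by norm_num) hnr
    linarith
  unfold prof
  have e : (d : ℝ) / (2 * n) - 2 = (n : ℝ)⁻¹ * (d / 2 - 2 * n) := by
    have h2 : (n : ℝ)⁻¹ * (2 * n) = 2 := by field_simp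
    rw [mul_sub, ← div_eq_inv_mul, div_div, h2]
  rw [e]
  exact mul_le_mul_of_nonneg_left hS (inv_nonneg.2 hnpos.le)

end Profile

/-! ## §2 The circle distance of one coordinate and its two neighbours -/

section Circle

variable {N : ℕ}

/-- The circle distance `min{(a−o) mod N, (o−a) mod N}` of two points of `ℤ/N` — the summand of r16's `ℓ^∞` torus distance `supDist`.
[cite: Balaban1982Higgs1, (1.3) p.604] -/
def cdist (o a : ZMod N) : ℕ := min (a - o).val (o - a).val

/-- kernel: `cdist` is symmetric. [cite: Balaban1982Higgs1, (1.3) p.604] -/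
theorem cdist_comm (o a : ZMod N) : cdist o a = cdist a o := min_comm _ _

variable [NeZero N]

/-- kernel: `cdist o a = min(r, N − r)`, `r = (a − o) mod N`. [cite: Balaban1982Higgs1, (1.3) p.604] -/
theorem cdist_eq_min (o a : ZMod N) : cdist o a = min (a - o).val (N - (a - o).val) := by
  unfold cdist
  have e : o - a = -(a - o) := by ring
  rw [e, ZMod.neg_val]
  split_ifs with h
  · rw [h, ZMod.val_zero]; simp
  · rfl

/-- kernel: `cdist o a ≤ a.val − o.val` when `o.val ≤ a.val`. [cite: Balaban1982Higgs1, (1.3) p.604] -/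
theorem cdist_le_of_le {o a : ZMod N} (h : o.val ≤ a.val) : cdist o a ≤ a.val - o.val := by
  unfold cdist; rw [← ZMod.val_sub h]; exact min_le_left _ _

/-- kernel: `cdist o a ≤ o.val − a.val` when `a.val ≤ o.val`. [cite: Balaban1982Higgs1, (1.3) p.604] -/
theorem cdist_le_of_ge {o a : ZMod N} (h : a.val ≤ o.val) : cdist o a ≤ o.val - a.val := by
  unfold cdist; rw [← ZMod.val_sub h]; exact min_le_right _ _

/-- kernel: the residue of `a + 1 − o`. [folklore] -/
private theorem val_add_one_sub (hN : 2 ≤ N) (o a : ZMod N) :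
    (a + 1 - o).val = if (a - o).val + 1 < N then (a - o).val + 1 else 0 := by
  have : Fact (1 < N) := ⟨by omega⟩
  have e : a + 1 - o = (a - o) + 1 := by ring
  rw [e, ZMod.val_add, ZMod.val_one]
  have hr : (a - o).val < N := ZMod.val_lt _
  split_ifs with h
  · exact Nat.mod_eq_of_lt h
  · have : (a - o).val + 1 = N := by omega
    rw [this, Nat.mod_self]

/-- kernel: the residue of `a − 1 − o`. [folklore] -/
private theorem val_sub_one_sub (hN : 2 ≤ N) (o a : ZMod N) :
    (a - 1 - o).val = if (a - o).val = 0 then N - 1 else (a - o).val - 1 := by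
  have : Fact (1 < N) := ⟨by omega⟩
  have e : a - 1 - o = (a - o) - 1 := by ring
  rw [e]
  split_ifs with h
  · have h0 : a - o = 0 := (ZMod.val_eq_zero _).1 h
    rw [h0, zero_sub, ZMod.neg_val, if_neg one_ne_zero, ZMod.val_one]
  · have h1 : (1 : ZMod N).val ≤ (a - o).val := by rw [ZMod.val_one]; omega
    rw [ZMod.val_sub h1, ZMod.val_one]

/-- kernel: the arithmetic of the two neighbours on a circle of even length (pure `ℕ`). [folklore] -/
private theorem circle_cases {N M r d0 d1 d2 : ℕ} (hM : N = M + M) (hN : 2 ≤ N) (hr : r < N) (e0 : d0 = min r (N - r))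
    (e1 : d1 = min (if r + 1 < N then r + 1 else 0) (N - if r + 1 < N then r + 1 else 0))
    (e2 : d2 = min (if r = 0 then N - 1 else r - 1) (N - if r = 0 then N - 1 else r - 1)) :
    (d1 = d0 + 1 ∧ d2 + 1 = d0) ∨ (d1 + 1 = d0 ∧ d2 = d0 + 1) ∨ (d0 = 0 ∧ d1 = 1 ∧ d2 = 1) ∨
    (2 * d0 = N ∧ d1 + 1 = d0 ∧ d2 + 1 = d0) := by
  subst hM
  by_cases h1 : r + 1 < M + M
  · rw [if_pos h1] at e1
    by_cases h2 : r = 0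
    · rw [if_pos h2] at e2
      subst h2
      right; right; left
      refine ⟨?_, ?_, ?_⟩ <;> omega
    · rw [if_neg h2] at e2
      rcases Nat.lt_or_ge (2 * r) (M + M) with h3 | h3
      · left; constructor <;> omega
      · rcases Nat.lt_or_ge (M + M) (2 * r) with h4 | h4
        · right; left; constructor <;> omega
        · right; right; right; refine ⟨?_, ?_, ?_⟩ <;> omega
  · rw [if_neg h1] at e1
    have h2 : r ≠ 0 := by omega
    rw [if_neg h2] at e2
    by_cases h3 : 2 * r = M + M
    · right; right; right; refine ⟨?_, ?_, ?_⟩ <;> omega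
    · right; left; constructor <;> omega

/-- kernel: **THE TWO NEIGHBOURS ON THE CIRCLE** (`N ≥ 2` even): with `d = cdist o a`, `d⁺ = cdist o (a+1)`, `d⁻ = cdist o (a−1)`, either
`{d⁺, d⁻} = {d+1, d−1}`, or `d = 0` and `d⁺ = d⁻ = 1` (the centre), or `2d = N` and `d⁺ = d⁻ = d − 1` (the antipode).
[cite: Balaban1982Higgs1, (1.3) p.604] -/
theorem cdist_neighbours (hN : 2 ≤ N) (hNe : Even N) (o a : ZMod N) :
    (cdist o (a + 1) = cdist o a + 1 ∧ cdist o (a - 1) + 1 = cdist o a) ∨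
    (cdist o (a + 1) + 1 = cdist o a ∧ cdist o (a - 1) = cdist o a + 1) ∨
    (cdist o a = 0 ∧ cdist o (a + 1) = 1 ∧ cdist o (a - 1) = 1) ∨
    (2 * cdist o a = N ∧ cdist o (a + 1) + 1 = cdist o a ∧ cdist o (a - 1) + 1 = cdist o a) := by
  obtain ⟨M, hM⟩ := hNe
  have hr : (a - o).val < N := ZMod.val_lt _
  have e0 := cdist_eq_min o a
  have e1 := cdist_eq_min o (a + 1)
  have e2 := cdist_eq_min o (a - 1)
  rw [val_add_one_sub hN] at e1
  rw [val_sub_one_sub hN] at e2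
  generalize hR : (a - o).val = r at hr e0 e1 e2
  generalize hD0 : cdist o a = d0 at e0 ⊢
  generalize hD1 : cdist o (a + 1) = d1 at e1 ⊢
  generalize hD2 : cdist o (a - 1) = d2 at e2 ⊢
  exact circle_cases hM hN hr e0 e1 e2

/-- kernel: **ACROSS A BLOCK FACE THE PROFILE ARGUMENT STEPS THROUGH A FLAT INCREMENT**: for `n ≥ 3` odd with `n ∣ N/2`, `N` even, a centre
`o` with `o ≡ (n−1)/2 (mod n)` and a face site `a ≡ n − 1 (mod n)`, the circle distances `d = cdist o a`, `d⁺ = cdist o (a+1)` satisfy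
`d⁺ = d + 1` with `n ∣ d + (n+1)/2`, or `d = d⁺ + 1` with `n ∣ d⁺ + (n+1)/2`. [cite: BalabanImbrieJaffe1985, (2.4) p.302] -/
theorem cdist_face {n : ℕ} (hn3 : 3 ≤ n) (hodd : n % 2 = 1) (hNe : Even N) (hnN2 : n ∣ N / 2) {o a : ZMod N}
    (ho : o.val % n = (n - 1) / 2) (ha : a.val % n = n - 1) :
    (cdist o (a + 1) = cdist o a + 1 ∧ n ∣ cdist o a + (n + 1) / 2) ∨
    (cdist o a = cdist o (a + 1) + 1 ∧ n ∣ cdist o (a + 1) + (n + 1) / 2) := by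
  obtain ⟨M, hM⟩ := hNe
  have hM2 : N / 2 = M := by omega
  rw [hM2] at hnN2
  have hnN : n ∣ N := by rw [hM, ← two_mul]; exact Dvd.dvd.mul_left hnN2 2
  have hN1 : 1 ≤ N := Nat.pos_of_ne_zero (NeZero.ne N)
  set r := (a - o).val with hrdef
  have hr : r < N := ZMod.val_lt _
  -- the key congruence `n ∣ r + (n+1)/2`
  have hkey : n ∣ r + (n + 1) / 2 := by
    have hval : a.val = (r + o.val) % N := by
      have e : a = (a - o) + o := by ring
      conv_lhs => rw [e]
      rw [ZMod.val_add]
    have h1 : r + o.val ≡ a.val [MOD n] := by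
      have h := (Nat.mod_modEq (r + o.val) N).symm
      rw [← hval] at h
      exact Nat.ModEq.of_dvd hnN h
    have h2 : o.val ≡ (n - 1) / 2 [MOD n] := by
      rw [Nat.ModEq, ho, Nat.mod_eq_of_lt (by omega)]
    have h3 : a.val ≡ n - 1 [MOD n] := by
      rw [Nat.ModEq, ha, Nat.mod_eq_of_lt (by omega)]
    have h4 : r + (n - 1) / 2 ≡ n - 1 [MOD n] := ((Nat.ModEq.add_left r h2).symm.trans h1).trans h3
    have h5 : r + (n - 1) / 2 + 1 ≡ n - 1 + 1 [MOD n] := Nat.ModEq.add_right 1 h4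
    have e6 : r + (n - 1) / 2 + 1 = r + (n + 1) / 2 := by omega
    have e7 : n - 1 + 1 = n := by omega
    rw [e6, e7] at h5
    exact (Nat.modEq_zero_iff_dvd.1 (h5.trans (Nat.modEq_zero_iff_dvd.2 dvd_rfl)))
  -- `r ≠ M` and `r + 1 ≠ N`
  have hc1 : (n + 1) / 2 < n := by omega
  have hc0 : 0 < (n + 1) / 2 := by omega
  have hrM : r ≠ M := by
    intro h
    rw [h] at hkey
    have h' : n ∣ (n + 1) / 2 := (Nat.dvd_add_right hnN2).1 hkey
    exact absurd (Nat.le_of_dvd hc0 h') (not_le.2 hc1)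
  have hrN : r + 1 ≠ N := by
    intro h
    have e : r + (n + 1) / 2 = N + (n - 1) / 2 := by omega
    rw [e] at hkey
    have h' : n ∣ (n - 1) / 2 := (Nat.dvd_add_right hnN).1 hkey
    rcases Nat.eq_zero_or_pos ((n - 1) / 2) with h0 | h0
    · omega
    · exact absurd (Nat.le_of_dvd h0 h') (by omega)
  have e0 := cdist_eq_min o a
  have e1 := cdist_eq_min o (a + 1)
  rw [val_add_one_sub (by omega) o a, if_pos (by omega)] at e1
  rw [← hrdef] at e0 e1
  rcases Nat.lt_or_gt_of_ne hrM with hlt | hgt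
  · left
    have hd : cdist o a = r := by rw [e0]; omega
    have hd' : cdist o (a + 1) = r + 1 := by rw [e1]; omega
    rw [hd, hd']
    exact ⟨rfl, hkey⟩
  · right
    have hd : cdist o a = N - r := by rw [e0]; omega
    have hd' : cdist o (a + 1) = N - r - 1 := by rw [e1]; omega
    rw [hd, hd']
    refine ⟨by omega, ?_⟩
    have hsum : (r + (n + 1) / 2) + (N - r - 1 + (n + 1) / 2) = N + n := by omega
    have hNn : n ∣ N + n := Dvd.dvd.add hnN dvd_rfl
    rw [← hsum] at hNn
    exact (Nat.dvd_add_right hkey).1 hNn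

/-- The centre of the `n`-block of `a` on the circle `ℤ/N` (`n` odd, blocks `[qn, qn + n)`): the point `qn + (n−1)/2`, `q = ⌊a/n⌋`
(the block (2.4) iterated; `L` odd, so the centre is a lattice point). [cite: BalabanImbrieJaffe1985, (2.4) p.302] -/
def ctr (n : ℕ) (a : ZMod N) : ZMod N := ((a.val / n * n + (n - 1) / 2 : ℕ) : ZMod N)

/-- kernel: the label of the centre (no wrap-around when `n ∣ N`). [cite: BalabanImbrieJaffe1985, (2.4) p.302] -/
theorem val_ctr {n : ℕ} (hn : 0 < n) (hnN : n ∣ N) (a : ZMod N) : (ctr n a).val = a.val / n * n + (n - 1) / 2 := by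
  obtain ⟨B, hB⟩ := hnN
  rw [ctr, ZMod.val_natCast, Nat.mod_eq_of_lt]
  have ha : a.val < N := ZMod.val_lt a
  have hq : a.val / n < B := by
    rw [Nat.div_lt_iff_lt_mul hn, mul_comm]; exact lt_of_lt_of_eq ha hB
  have h1 : a.val / n * n + n ≤ B * n := by
    have := Nat.mul_le_mul_right n (Nat.succ_le_of_lt hq)
    rw [Nat.succ_mul] at this
    exact this
  have h2 : (n - 1) / 2 < n := by omega
  calc a.val / n * n + (n - 1) / 2 < a.val / n * n + n := by omega
    _ ≤ B * n := h1
    _ = N := by rw [hB, mul_comm]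

/-- kernel: the centre sits at position `(n−1)/2` of its block. [cite: BalabanImbrieJaffe1985, (2.4) p.302] -/
theorem ctr_mod {n : ℕ} (hn : 0 < n) (hnN : n ∣ N) (a : ZMod N) : (ctr n a).val % n = (n - 1) / 2 := by
  rw [val_ctr hn hnN, mul_comm, Nat.mul_add_mod]
  exact Nat.mod_eq_of_lt (by omega)

end Circle

/-! ## §3 The block centre of `x` and the weight `ψ_x(y) = tΣ_μ F(cdist((o_x)_μ, y_μ))` on the fine torus -/

section Torus

variable {P : Params}

/-- kernel: `L^k ∣ 2L^{m+K}` sites per direction (standing range `k ≤ m + K`). [cite: BalabanImbrieJaffe1985, (2.4) p.302] -/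
theorem pow_dvd_sitesPerDir {k : ℕ} (hk : k ≤ P.m + P.K) : P.L ^ k ∣ P.sitesPerDir 0 := by
  unfold Params.sitesPerDir
  have e : P.m + P.K - 0 = (P.m + P.K - k) + k := by omega
  rw [e, pow_add, ← mul_assoc]
  exact dvd_mul_left _ _

/-- kernel: `L^k ∣ L^{m+K} = (2L^{m+K})/2`. [cite: BalabanImbrieJaffe1985, (2.4) p.302] -/
theorem pow_dvd_sitesPerDir_half {k : ℕ} (hk : k ≤ P.m + P.K) : P.L ^ k ∣ P.sitesPerDir 0 / 2 := by
  unfold Params.sitesPerDir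
  rw [Nat.sub_zero, Nat.mul_div_cancel_left _ two_pos]
  exact pow_dvd_pow _ hk

/-- kernel: the finest torus has `2L^{m+K}` sites per direction ([12] (0.1)): an even number `≥ 2`. [cite: Balaban1987RG1, (0.1) p.251] -/
theorem sitesPerDir_even_two_le : Even (P.sitesPerDir 0) ∧ 2 ≤ P.sitesPerDir 0 := by
  refine ⟨⟨P.L ^ (P.m + P.K - 0), by unfold Params.sitesPerDir; ring⟩, ?_⟩
  have := P.one_lt_sitesPerDir 0; omega

/-- kernel: `L` is odd and `> 1` ([12] §0), so `n = L^k` is odd, and `≥ 3` once `k ≥ 1`. [cite: Balaban1987RG1, §0 p.251] -/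
theorem pow_L_odd_three_le {k : ℕ} (hk1 : 1 ≤ k) : P.L ^ k % 2 = 1 ∧ 3 ≤ P.L ^ k := by
  obtain ⟨hodd, hL⟩ := P.hL
  have hL3 : 3 ≤ P.L := by rcases hodd with ⟨r, hr⟩; omega
  refine ⟨Nat.odd_iff.1 (Odd.pow hodd), ?_⟩
  calc 3 ≤ P.L ^ 1 := by rw [pow_one]; exact hL3
    _ ≤ P.L ^ k := Nat.pow_le_pow_right (by omega) hk1

/-- **THE CENTRE OF THE `k`-BLOCK OF `x`**, coordinatewise (`L` odd: a site of the block). [cite: BalabanImbrieJaffe1985, (2.4) p.302] -/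
def centre (k : ℕ) (x : Balaban1983to89.Site P 0) : Balaban1983to89.Site P 0 := fun μ => ctr (P.L ^ k) (x μ)

/-- kernel: the centre lies in the `k`-block of `x`: `(centre x)_k = x_k`. [cite: BalabanImbrieJaffe1985, (2.4) p.302] -/
theorem blkIter_centre {k : ℕ} (hk : k ≤ P.m + P.K) (x : Balaban1983to89.Site P 0) : blkIter k (centre k x) = blkIter k x := by
  have hk0 : 0 + k ≤ P.m + P.K := by omega
  have hn : 0 < P.L ^ k := pow_pos P.L_pos k
  funext μ
  apply ZMod.val_injective
  rw [val_blkIter k hk0, val_blkIter k hk0]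
  show (ctr (P.L ^ k) (x μ)).val / P.L ^ k = (x μ).val / P.L ^ k
  rw [val_ctr hn (pow_dvd_sitesPerDir hk), mul_comm, Nat.mul_add_div hn,
    Nat.div_eq_of_lt (a := (P.L ^ k - 1) / 2) (b := P.L ^ k) (by omega), add_zero]

/-- kernel: `|x − centre x|_∞ ≤ L^k − 1`. [cite: BalabanImbrieJaffe1985, (2.4) p.302] -/
theorem supDist_centre_le {k : ℕ} (hk : k ≤ P.m + P.K) (x : Balaban1983to89.Site P 0) : supDist x (centre k x) ≤ P.L ^ k - 1 :=
  BIJ85ScalarPropagatorDecay.supDist_le_of_blkIter_eq (by omega : 0 + k ≤ P.m + P.K) (blkIter_centre hk x).symm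

/-- kernel: the circle distance from a point to its block centre is at most `(n−1)/2`. [cite: BalabanImbrieJaffe1985, (2.4) p.302] -/
theorem cdist_ctr_le {N n : ℕ} [NeZero N] (hn : 0 < n) (hodd : n % 2 = 1) (hnN : n ∣ N) (a : ZMod N) :
    cdist (ctr n a) a ≤ (n - 1) / 2 := by
  have hv := val_ctr hn hnN a
  have hdm := Nat.div_add_mod (a.val) n
  have hlt : a.val % n < n := Nat.mod_lt _ hn
  have hsplit : a.val = a.val / n * n + a.val % n := by rw [mul_comm]; exact hdm.symm
  rcases le_total (ctr n a).val a.val with h | h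
  · refine (cdist_le_of_le h).trans ?_
    rw [hv] at h ⊢
    generalize hq : a.val / n * n = qn at h hsplit ⊢
    omega
  · refine (cdist_le_of_ge h).trans ?_
    rw [hv] at h ⊢
    generalize hq : a.val / n * n = qn at h hsplit ⊢
    omega

/-- kernel: r16's `ℓ^∞` distance is the maximum of the circle distances of the coordinates. [cite: Balaban1982Higgs1, (1.3) p.604] -/
theorem supDist_eq_sup_cdist (o y : Balaban1983to89.Site P 0) : supDist o y = univ.sup fun μ => cdist (o μ) (y μ) := by
  unfold supDist cdist
  congr 1
  funext μ
  rw [min_comm]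

/-- **THE WEIGHT `ψ_x(y) = t·Σ_μ F(cdist((centre x)_μ, y_μ))`** (kernel device of the sup-norm route: the block-centred replacement of the
lineage's `t|x−y|_∞/L^k`). [cite: BalabanImbrieJaffe1985, (7.3.2) p.326] -/
def psi (k : ℕ) (t : ℝ) (x y : Balaban1983to89.Site P 0) : ℝ := t * ∑ μ : Fin P.d, prof (P.L ^ k) (cdist (centre k x μ) (y μ))

/-- kernel: `ψ ≥ 0` for `t ≥ 0`. [cite: BalabanImbrieJaffe1985, (7.3.2) p.326] -/
theorem psi_nonneg (k : ℕ) {t : ℝ} (ht : 0 ≤ t) (x y : Balaban1983to89.Site P 0) : 0 ≤ psi k t x y :=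
  mul_nonneg ht (sum_nonneg fun _ _ => prof_nonneg (pow_pos P.L_pos k) _)

/-- kernel: **at its own centre-block point the weight is small**: `ψ_x(x) ≤ tD/2`. [cite: BalabanImbrieJaffe1985, (7.3.2) p.326] -/
theorem psi_self_le {k : ℕ} (hk : k ≤ P.m + P.K) {t : ℝ} (ht : 0 ≤ t) (x : Balaban1983to89.Site P 0) : psi k t x x ≤ t * P.d / 2 := by
  have hn : 0 < P.L ^ k := pow_pos P.L_pos k
  have hnr : (0 : ℝ) < (P.L ^ k : ℕ) := by exact_mod_cast hn
  have hterm : ∀ μ : Fin P.d, prof (P.L ^ k) (cdist (centre k x μ) (x μ)) ≤ 1 / 2 := by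
    intro μ
    have h1 := prof_le hn (cdist (centre k x μ) (x μ))
    have h2 : cdist (centre k x μ) (x μ) ≤ (P.L ^ k - 1) / 2 :=
      cdist_ctr_le hn (Nat.odd_iff.1 (Odd.pow P.hL.1)) (pow_dvd_sitesPerDir hk) (x μ)
    have h3 : ((cdist (centre k x μ) (x μ) : ℕ) : ℝ) ≤ ((P.L ^ k : ℕ) : ℝ) / 2 := by
      have h4 : (((P.L ^ k - 1) / 2 : ℕ) : ℝ) ≤ ((P.L ^ k : ℕ) : ℝ) / 2 := by
        rw [le_div_iff₀ (by norm_num : (0:ℝ) < 2)]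
        have : (P.L ^ k - 1) / 2 * 2 ≤ P.L ^ k := by omega
        exact_mod_cast this
      exact (Nat.cast_le.2 h2).trans h4
    refine h1.trans ?_
    rw [div_le_iff₀ hnr]
    linarith
  unfold psi
  calc t * ∑ μ : Fin P.d, prof (P.L ^ k) (cdist (centre k x μ) (x μ)) ≤ t * ∑ _μ : Fin P.d, (1 / 2 : ℝ) :=
        mul_le_mul_of_nonneg_left (sum_le_sum fun μ _ => hterm μ) ht
    _ = t * P.d / 2 := by rw [sum_const, card_univ, Fintype.card_fin, nsmul_eq_mul]; ring

/-- kernel: a coordinate update changes only one term of `Σ_μ G_μ(y_μ)`. [folklore] -/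
private theorem sum_update_sub (G : Fin P.d → ZMod (P.sitesPerDir 0) → ℝ) (y : Balaban1983to89.Site P 0) (μ : Fin P.d)
    (v : ZMod (P.sitesPerDir 0)) :
    ∑ ν, G ν (Function.update y μ v ν) - ∑ ν, G ν (y ν) = G μ v - G μ (y μ) := by
  rw [← sum_sub_distrib, Finset.sum_eq_single μ]
  · rw [Function.update_self]
  · intro ν _ hν; rw [Function.update_of_ne hν, sub_self]
  · exact fun h => absurd (mem_univ _) h

/-- kernel: the increment of `ψ` along the bond `⟨y, y+e_μ⟩` is the increment of the `μ`-th profile term. [cite: BalabanImbrieJaffe1985, (7.3.2) p.326] -/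
theorem psi_shift_sub (k : ℕ) (t : ℝ) (x y : Balaban1983to89.Site P 0) (μ : Fin P.d) :
    psi k t x (y.shift μ) - psi k t x y =
      t * (prof (P.L ^ k) (cdist (centre k x μ) (y μ + 1)) - prof (P.L ^ k) (cdist (centre k x μ) (y μ))) := by
  unfold psi
  rw [← mul_sub]
  congr 1
  exact sum_update_sub (fun ν a => prof (P.L ^ k) (cdist (centre k x ν) a)) y μ (y μ + 1)

/-- kernel: the increment of `ψ` along the bond `⟨y−e_μ, y⟩`, read backwards. [cite: BalabanImbrieJaffe1985, (7.3.2) p.326] -/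
theorem psi_unshift_sub (k : ℕ) (t : ℝ) (x y : Balaban1983to89.Site P 0) (μ : Fin P.d) :
    psi k t x (y.unshift μ) - psi k t x y =
      t * (prof (P.L ^ k) (cdist (centre k x μ) (y μ - 1)) - prof (P.L ^ k) (cdist (centre k x μ) (y μ))) := by
  unfold psi
  rw [← mul_sub]
  congr 1
  exact sum_update_sub (fun ν a => prof (P.L ^ k) (cdist (centre k x ν) a)) y μ (y μ - 1)

/-- kernel: the profile changes by at most `1/n` between neighbouring circle distances. [cite: BalabanImbrieJaffe1985, (7.3.2) p.326] -/
theorem abs_prof_neighbour_le {n d d' : ℕ} (hn : 0 < n) (h : d' = d + 1 ∨ d' + 1 = d) : |prof n d' - prof n d| ≤ 1 / n := by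
  rcases h with h | h
  · rw [h, abs_of_nonneg (prof_sub_le hn d).1]; exact (prof_sub_le hn d).2
  · rw [← h, abs_sub_comm, abs_of_nonneg (prof_sub_le hn d').1]; exact (prof_sub_le hn d').2

/-- **BOND LIPSCHITZ**: `|ψ_x(y + e_μ) − ψ_x(y)| ≤ t/L^k` (`t ≥ 0`). [cite: BalabanImbrieJaffe1985, (7.3.2) p.326] -/
theorem psi_shift_sub_abs_le (k : ℕ) {t : ℝ} (ht : 0 ≤ t) (x y : Balaban1983to89.Site P 0) (μ : Fin P.d) :
    |psi k t x (y.shift μ) - psi k t x y| ≤ t / (P.L : ℝ) ^ k := by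
  have hn : 0 < P.L ^ k := pow_pos P.L_pos k
  obtain ⟨hNe, hN2⟩ := sitesPerDir_even_two_le (P := P)
  rw [psi_shift_sub, abs_mul, abs_of_nonneg ht, div_eq_mul_one_div]
  refine mul_le_mul_of_nonneg_left ?_ ht
  have hc := cdist_neighbours hN2 hNe (centre k x μ) (y μ)
  have h := abs_prof_neighbour_le (d := cdist (centre k x μ) (y μ)) (d' := cdist (centre k x μ) (y μ + 1)) hn (by omega)
  have e : ((P.L ^ k : ℕ) : ℝ) = (P.L : ℝ) ^ k := by push_cast; ring
  rw [e] at h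
  exact h

/-- **BOND LIPSCHITZ, backwards**: `|ψ_x(y − e_μ) − ψ_x(y)| ≤ t/L^k` (`t ≥ 0`). [cite: BalabanImbrieJaffe1985, (7.3.2) p.326] -/
theorem psi_unshift_sub_abs_le (k : ℕ) {t : ℝ} (ht : 0 ≤ t) (x y : Balaban1983to89.Site P 0) (μ : Fin P.d) :
    |psi k t x (y.unshift μ) - psi k t x y| ≤ t / (P.L : ℝ) ^ k := by
  have hn : 0 < P.L ^ k := pow_pos P.L_pos k
  obtain ⟨hNe, hN2⟩ := sitesPerDir_even_two_le (P := P)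
  rw [psi_unshift_sub, abs_mul, abs_of_nonneg ht, div_eq_mul_one_div]
  refine mul_le_mul_of_nonneg_left ?_ ht
  have hc := cdist_neighbours hN2 hNe (centre k x μ) (y μ)
  have h := abs_prof_neighbour_le (d := cdist (centre k x μ) (y μ)) (d' := cdist (centre k x μ) (y μ - 1)) hn (by omega)
  have e : ((P.L ^ k : ℕ) : ℝ) = (P.L : ℝ) ^ k := by push_cast; ring
  rw [e] at h
  exact h

/-- kernel: if `m mod n ≠ n − 1` then `(m+1)/n = m/n`. [folklore] -/
private theorem succ_div_of_mod_ne {n m : ℕ} (hn : 0 < n) (h : m % n ≠ n - 1) : (m + 1) / n = m / n := by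
  have hdm := Nat.div_add_mod m n
  have hlt : m % n < n := Nat.mod_lt _ hn
  have e : m + 1 = n * (m / n) + (m % n + 1) := by omega
  rw [e, Nat.mul_add_div hn, Nat.div_eq_of_lt (a := m % n + 1) (b := n) (by omega), add_zero]

/-- kernel: **a bond leaves the `k`-block only at a face**: if `(y + e_μ)_k ≠ y_k` then `y_μ ≡ L^k − 1 (mod L^k)`.
[cite: BalabanImbrieJaffe1985, (2.4) p.302] -/
theorem val_mod_eq_of_blkIter_shift_ne {k : ℕ} (hk : k ≤ P.m + P.K) {y : Balaban1983to89.Site P 0} {μ : Fin P.d}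
    (hne : blkIter k (y.shift μ) ≠ blkIter k y) : (y μ).val % P.L ^ k = P.L ^ k - 1 := by
  by_contra h
  apply hne
  have hk0 : 0 + k ≤ P.m + P.K := by omega
  have hn : 0 < P.L ^ k := pow_pos P.L_pos k
  obtain ⟨B, hB⟩ := pow_dvd_sitesPerDir (P := P) hk
  have hN2 := (sitesPerDir_even_two_le (P := P)).2
  have : Fact (1 < P.sitesPerDir 0) := ⟨by omega⟩
  funext ν
  apply ZMod.val_injective
  rw [val_blkIter k hk0, val_blkIter k hk0]
  by_cases hν : ν = μ
  · subst hν
    have hv : (y ν).val < P.sitesPerDir 0 := ZMod.val_lt _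
    -- no wrap-around: `val + 1 < N` (else `val = N − 1 ≡ n − 1`)
    have hlt : (y ν).val + 1 < P.sitesPerDir 0 := by
      by_contra hge
      have heq : (y ν).val + 1 = P.sitesPerDir 0 := by omega
      apply h
      have hB1 : 1 ≤ B := by
        rcases Nat.eq_zero_or_pos B with h0 | h0
        · rw [h0, mul_zero] at hB; omega
        · exact h0
      have e : (y ν).val = P.L ^ k * (B - 1) + (P.L ^ k - 1) := by
        have : P.L ^ k * B = P.L ^ k * (B - 1) + P.L ^ k := by
          rw [← Nat.mul_succ]; congr 1; omega
        omega
      rw [e, Nat.mul_add_mod, Nat.mod_eq_of_lt (by omega)]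
    have hval : (y.shift ν ν).val = (y ν).val + 1 := by
      simp only [Balaban1983to89.Site.shift, Function.update_self]
      rw [ZMod.val_add, ZMod.val_one, Nat.mod_eq_of_lt hlt]
    rw [hval, succ_div_of_mod_ne hn h]
  · simp only [Balaban1983to89.Site.shift, Function.update_of_ne hν]

/-- **FLAT ACROSS THE BONDS LEAVING A BLOCK UNION (forward)**: if `Ω` is a union of `k`-blocks, `y ∈ Ω` and `⟨y, y+e_μ⟩ ∉ Ω*`, then
`ψ_x(y + e_μ) = ψ_x(y)` (`1 ≤ k ≤ m + K`). [cite: BalabanImbrieJaffe1988, (2.27) p.263] -/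
theorem psi_shift_eq_of_not_mem_starB {k : ℕ} (hk1 : 1 ≤ k) (hk : k ≤ P.m + P.K) {Ω : Finset (Balaban1983to89.Site P 0)}
    (hΩ : IsBlockUnion k Ω) (t : ℝ) (x : Balaban1983to89.Site P 0) {y : Balaban1983to89.Site P 0} (hy : y ∈ Ω) {μ : Fin P.d}
    (hb : (⟨y, μ⟩ : PBond P 0) ∉ starB Ω) : psi k t x (y.shift μ) = psi k t x y := by
  have hn : 0 < P.L ^ k := pow_pos P.L_pos k
  obtain ⟨hodd, hn3⟩ := pow_L_odd_three_le (P := P) hk1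
  obtain ⟨hNe, hN2⟩ := sitesPerDir_even_two_le (P := P)
  -- the far end is outside `Ω`, hence outside the `k`-block of `y`
  have hout : y.shift μ ∉ Ω := fun h => hb ((mem_starB Ω _).2 ⟨hy, h⟩)
  have hne : blkIter k (y.shift μ) ≠ blkIter k y := fun h => hout (hΩ y hy (mem_blockK.2 h))
  have hface := val_mod_eq_of_blkIter_shift_ne hk hne
  have hctr : (centre k x μ).val % P.L ^ k = (P.L ^ k - 1) / 2 := ctr_mod hn (pow_dvd_sitesPerDir hk) (x μ)
  have hc := cdist_face hn3 hodd hNe (pow_dvd_sitesPerDir_half hk) hctr hface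
  rw [← sub_eq_zero, psi_shift_sub, mul_eq_zero]
  right
  rcases hc with ⟨h1, h2⟩ | ⟨h1, h2⟩
  · rw [h1, prof_face h2, sub_self]
  · rw [h1, prof_face h2, sub_self]

/-- **FLAT ACROSS THE BONDS LEAVING A BLOCK UNION (backward)**: if `Ω` is a union of `k`-blocks, `y ∈ Ω` and `⟨y−e_μ, y⟩ ∉ Ω*`, then
`ψ_x(y − e_μ) = ψ_x(y)`. [cite: BalabanImbrieJaffe1988, (2.27) p.263] -/
theorem psi_unshift_eq_of_not_mem_starB {k : ℕ} (hk1 : 1 ≤ k) (hk : k ≤ P.m + P.K) {Ω : Finset (Balaban1983to89.Site P 0)}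
    (hΩ : IsBlockUnion k Ω) (t : ℝ) (x : Balaban1983to89.Site P 0) {y : Balaban1983to89.Site P 0} (hy : y ∈ Ω) {μ : Fin P.d}
    (hb : (⟨y.unshift μ, μ⟩ : PBond P 0) ∉ starB Ω) : psi k t x (y.unshift μ) = psi k t x y := by
  have hn : 0 < P.L ^ k := pow_pos P.L_pos k
  obtain ⟨hodd, hn3⟩ := pow_L_odd_three_le (P := P) hk1
  obtain ⟨hNe, hN2⟩ := sitesPerDir_even_two_le (P := P)
  have ey : (y.unshift μ).shift μ = y := (shiftEquiv μ).right_inv y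
  have hout : y.unshift μ ∉ Ω := by
    intro h
    exact hb ((mem_starB Ω _).2 ⟨h, by rw [show (⟨y.unshift μ, μ⟩ : PBond P 0).tgt = y from ey]; exact hy⟩)
  have hne : blkIter k ((y.unshift μ).shift μ) ≠ blkIter k (y.unshift μ) := by
    rw [ey]; exact fun h => hout (hΩ y hy (mem_blockK.2 h.symm))
  have hface := val_mod_eq_of_blkIter_shift_ne hk hne
  have hctr : (centre k x μ).val % P.L ^ k = (P.L ^ k - 1) / 2 := ctr_mod hn (pow_dvd_sitesPerDir hk) (x μ)
  have hc := cdist_face hn3 hodd hNe (pow_dvd_sitesPerDir_half hk) hctr hface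
  have ea : (y.unshift μ) μ + 1 = y μ := by
    simp only [Balaban1983to89.Site.unshift, Function.update_self]; ring
  have ea' : (y.unshift μ) μ = y μ - 1 := by
    simp only [Balaban1983to89.Site.unshift, Function.update_self]
  rw [ea] at hc
  rw [ea'] at hc
  rw [← sub_eq_zero, psi_unshift_sub, mul_eq_zero]
  right
  rcases hc with ⟨h1, h2⟩ | ⟨h1, h2⟩
  · rw [h1, prof_face h2, sub_self]
  · rw [h1, prof_face h2, sub_self]

/-- kernel: `e^a + e^b − 2 ≤ (a + b) + (a² + b²)` for `|a|, |b| ≤ 1`. [folklore] -/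
private theorem exp_add_exp_sub_two_le {a b : ℝ} (ha : |a| ≤ 1) (hb : |b| ≤ 1) :
    Real.exp a + Real.exp b - 2 ≤ (a + b) + (a ^ 2 + b ^ 2) := by
  have h1 := (abs_le.1 (Real.abs_exp_sub_one_sub_id_le ha)).2
  have h2 := (abs_le.1 (Real.abs_exp_sub_one_sub_id_le hb)).2
  linarith

/-- **THE ONE-STEP DRIFT OF THE WEIGHT IS OF SECOND ORDER AT EVERY SITE**: for `0 ≤ t ≤ 1` and `1 ≤ k ≤ m + K`,
`Σ_μ(e^{ψ_x(y+e_μ)−ψ_x(y)} + e^{ψ_x(y−e_μ)−ψ_x(y)} − 2) ≤ D(8t + 2t²)/L^{2k}` (`D = P.d`): per coordinate the two neighbours sit at circle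
distances `d ± 1` (second difference of `F`, `≤ 8/n²`), or `1, 1` at the centre (`F(1) = F(0)`), or `d−1, d−1` at the antipode (`F`
nondecreasing); the quadratic terms are `≤ 2(t/n)²`. [cite: BalabanImbrieJaffe1985, (7.3.2) p.326] -/
theorem psi_drift_le {k : ℕ} (hk1 : 1 ≤ k) {t : ℝ} (ht0 : 0 ≤ t) (ht1 : t ≤ 1) (x y : Balaban1983to89.Site P 0) :
    ∑ μ : Fin P.d, (Real.exp (psi k t x (y.shift μ) - psi k t x y) + Real.exp (psi k t x (y.unshift μ) - psi k t x y) - 2) ≤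
      P.d * ((8 * t + 2 * t ^ 2) / ((P.L : ℝ) ^ k) ^ 2) := by
  have hn : 0 < P.L ^ k := pow_pos P.L_pos k
  obtain ⟨_, hn3⟩ := pow_L_odd_three_le (P := P) hk1
  obtain ⟨hNe, hN2⟩ := sitesPerDir_even_two_le (P := P)
  have e : ((P.L ^ k : ℕ) : ℝ) = (P.L : ℝ) ^ k := by push_cast; ring
  have hnr : (3 : ℝ) ≤ (P.L : ℝ) ^ k := by rw [← e]; exact_mod_cast hn3
  have hnpos : (0 : ℝ) < (P.L : ℝ) ^ k := by linarith
  have hterm : ∀ μ : Fin P.d, Real.exp (psi k t x (y.shift μ) - psi k t x y) + Real.exp (psi k t x (y.unshift μ) - psi k t x y) - 2 ≤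
      (8 * t + 2 * t ^ 2) / ((P.L : ℝ) ^ k) ^ 2 := by
    intro μ
    set A := psi k t x (y.shift μ) - psi k t x y with hA
    set B := psi k t x (y.unshift μ) - psi k t x y with hB
    have hA1 : |A| ≤ t / (P.L : ℝ) ^ k := psi_shift_sub_abs_le k ht0 x y μ
    have hB1 : |B| ≤ t / (P.L : ℝ) ^ k := psi_unshift_sub_abs_le k ht0 x y μ
    have htn : t / (P.L : ℝ) ^ k ≤ 1 := by rw [div_le_one hnpos]; linarith
    have hsq : A ^ 2 + B ^ 2 ≤ 2 * (t / (P.L : ℝ) ^ k) ^ 2 := by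
      have h1 : A ^ 2 ≤ (t / (P.L : ℝ) ^ k) ^ 2 := by
        rw [← sq_abs]; exact pow_le_pow_left₀ (abs_nonneg _) hA1 2
      have h2 : B ^ 2 ≤ (t / (P.L : ℝ) ^ k) ^ 2 := by
        rw [← sq_abs]; exact pow_le_pow_left₀ (abs_nonneg _) hB1 2
      linarith
    -- the linear part: the three cases of the circle
    have hlin : A + B ≤ t * (8 / ((P.L : ℝ) ^ k) ^ 2) := by
      rw [hA, hB, psi_shift_sub, psi_unshift_sub, ← mul_add]
      refine mul_le_mul_of_nonneg_left ?_ ht0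
      have hc := cdist_neighbours hN2 hNe (centre k x μ) (y μ)
      have h8 : (0 : ℝ) ≤ 8 / ((P.L : ℝ) ^ k) ^ 2 := by positivity
      rcases hc with ⟨h1, h2⟩ | ⟨h1, h2⟩ | ⟨h0, h1, h2⟩ | ⟨_, h1, h2⟩
      · -- `d⁺ = d + 1`, `d⁻ = d − 1`
        have hsd := prof_second_diff_le hn (cdist (centre k x μ) (y μ - 1))
        rw [e] at hsd
        have ed : cdist (centre k x μ) (y μ) = cdist (centre k x μ) (y μ - 1) + 1 := h2.symm
        rw [h1, ed]
        have e2 : cdist (centre k x μ) (y μ - 1) + 1 + 1 = cdist (centre k x μ) (y μ - 1) + 2 := rfl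
        rw [e2]
        linarith
      · -- `d⁺ = d − 1`, `d⁻ = d + 1`
        have hsd := prof_second_diff_le hn (cdist (centre k x μ) (y μ + 1))
        rw [e] at hsd
        have ed : cdist (centre k x μ) (y μ) = cdist (centre k x μ) (y μ + 1) + 1 := h1.symm
        rw [h2, ed]
        have e2 : cdist (centre k x μ) (y μ + 1) + 1 + 1 = cdist (centre k x μ) (y μ + 1) + 2 := rfl
        rw [e2]
        linarith
      · -- the centre
        rw [h0, h1, h2, prof_one, prof_zero]
        simp only [sub_self, add_zero]
        exact h8
      · -- the antipode
        have hm := prof_mono hn (show cdist (centre k x μ) (y μ + 1) ≤ cdist (centre k x μ) (y μ) by omega)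
        have hm' := prof_mono hn (show cdist (centre k x μ) (y μ - 1) ≤ cdist (centre k x μ) (y μ) by omega)
        linarith
    have hE := exp_add_exp_sub_two_le (hA1.trans htn) (hB1.trans htn)
    have e2 : t * (8 / ((P.L : ℝ) ^ k) ^ 2) + 2 * (t / (P.L : ℝ) ^ k) ^ 2 = (8 * t + 2 * t ^ 2) / ((P.L : ℝ) ^ k) ^ 2 := by
      rw [div_pow]; ring
    linarith
  calc ∑ μ : Fin P.d, (Real.exp (psi k t x (y.shift μ) - psi k t x y) + Real.exp (psi k t x (y.unshift μ) - psi k t x y) - 2)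
      ≤ ∑ _μ : Fin P.d, (8 * t + 2 * t ^ 2) / ((P.L : ℝ) ^ k) ^ 2 := sum_le_sum fun μ _ => hterm μ
    _ = P.d * ((8 * t + 2 * t ^ 2) / ((P.L : ℝ) ^ k) ^ 2) := by rw [sum_const, card_univ, Fintype.card_fin, nsmul_eq_mul]

/-- **THE WEIGHT DOMINATES THE `ℓ^∞` DISTANCE**: `ψ_x(y) ≥ t(|x − y|_∞/(2L^k) − 5/2)` (`t ≥ 0`, `1 ≤ k ≤ m + K`): the largest circle
distance from the centre is `|centre x − y|_∞ ≥ |x − y|_∞ − (L^k − 1)` and `F(d) ≥ d/(2n) − 2`. [cite: BalabanImbrieJaffe1985, (7.3.2) p.326] -/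
theorem psi_ge {k : ℕ} (hk1 : 1 ≤ k) (hk : k ≤ P.m + P.K) {t : ℝ} (ht : 0 ≤ t) (x y : Balaban1983to89.Site P 0) :
    t * ((supDist x y : ℝ) / (2 * (P.L : ℝ) ^ k) - 5 / 2) ≤ psi k t x y := by
  have hn : 0 < P.L ^ k := pow_pos P.L_pos k
  obtain ⟨_, hn3⟩ := pow_L_odd_three_le (P := P) hk1
  have e : ((P.L ^ k : ℕ) : ℝ) = (P.L : ℝ) ^ k := by push_cast; ring
  have hnr : (3 : ℝ) ≤ (P.L : ℝ) ^ k := by rw [← e]; exact_mod_cast hn3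
  have hnpos : (0 : ℝ) < (P.L : ℝ) ^ k := by linarith
  unfold psi
  refine mul_le_mul_of_nonneg_left ?_ ht
  -- the maximal coordinate
  have hne : (univ : Finset (Fin P.d)).Nonempty := ⟨⟨0, P.hd⟩, mem_univ _⟩
  obtain ⟨μ, -, hμ⟩ := exists_mem_eq_sup univ hne (fun ν => cdist (centre k x ν) (y ν))
  have hsup : supDist (centre k x) y = cdist (centre k x μ) (y μ) := by rw [supDist_eq_sup_cdist, hμ]
  have h1 : prof (P.L ^ k) (cdist (centre k x μ) (y μ)) ≤ ∑ ν : Fin P.d, prof (P.L ^ k) (cdist (centre k x ν) (y ν)) :=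
    single_le_sum (f := fun ν => prof (P.L ^ k) (cdist (centre k x ν) (y ν))) (fun ν _ => prof_nonneg hn _) (mem_univ μ)
  refine le_trans ?_ h1
  have h2 := prof_ge hn3 (cdist (centre k x μ) (y μ))
  rw [e, ← hsup] at h2
  rw [← hsup]
  refine le_trans ?_ h2
  -- `|centre x − y|_∞ ≥ |x − y|_∞ − (L^k − 1)`
  have htri := BIJ85Ineq722Torus.supDist_triangle x (centre k x) y
  have hc := supDist_centre_le hk x
  have h3 : ((supDist x y : ℕ) : ℝ) ≤ (supDist (centre k x) y : ℕ) + ((P.L : ℝ) ^ k - 1) := by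
    have h4 : ((supDist x (centre k x) : ℕ) : ℝ) ≤ (P.L : ℝ) ^ k - 1 := by
      have h5 : ((supDist x (centre k x) : ℕ) : ℝ) ≤ ((P.L ^ k - 1 : ℕ) : ℝ) := by exact_mod_cast hc
      rw [Nat.cast_sub (Nat.one_le_pow _ _ P.L_pos), e, Nat.cast_one] at h5
      exact h5
    have h6 : ((supDist x y : ℕ) : ℝ) ≤ ((supDist x (centre k x) + supDist (centre k x) y : ℕ) : ℝ) := by exact_mod_cast htri
    push_cast at h6
    linarith
  have h7 : ((supDist x y : ℕ) : ℝ) / (2 * (P.L : ℝ) ^ k) ≤ ((supDist (centre k x) y : ℕ) + ((P.L : ℝ) ^ k - 1)) / (2 * (P.L : ℝ) ^ k) :=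
    div_le_div_of_nonneg_right h3 (by positivity)
  have h8 : ((supDist (centre k x) y : ℕ) + ((P.L : ℝ) ^ k - 1)) / (2 * (P.L : ℝ) ^ k) =
      (supDist (centre k x) y : ℕ) / (2 * (P.L : ℝ) ^ k) + ((P.L : ℝ) ^ k - 1) / (2 * (P.L : ℝ) ^ k) := add_div _ _ _
  have h9 : ((P.L : ℝ) ^ k - 1) / (2 * (P.L : ℝ) ^ k) ≤ 1 / 2 := by
    rw [div_le_iff₀ (by positivity)]; linarith
  linarith

end Torus

end

end Literature.MathematicalPhysics.QuantumFieldTheory.BalabanImbrieJaffe1984to88.BIJ88BlockCentredWeight
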